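import Literature.NumberTheory.ConnesConsani2021.QuasiInnerFactorPrimeResidues
import Literature.NumberTheory.ConnesConsani2021.QuasiInnerProductAlgebra
import HarnessLib

/-!
# Connes–Consani 2021 (JNT) §4.4, proof of Theorem 4.8 — the operator assembly for one factor:
# `(1 − 𝒫)κ^{(m,k)}κ_p𝒫 = ℰ_∞ + ℰ_p + ℰ₀` is an infinitesimal of order `1/(2m)`; Theorem 4.8 PROVED

LINE 1 — LABEL: RH-FREE corpus literature (an order estimate for a bounded operator on `L²(S¹)` built from
the ratios of local factors `ρ_∞^{(m,k)}` (Lemma 4.7) and `ρ_p`; no positivity statement, no statement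
about zeros of `ζ`); bears_on: W-C/W-P (P5 sequel vocabulary, no leaf role); WHAT THIS IS NOT: any claim
about RH — nothing in this file bears on the truth of RH.

Source: A. Connes, C. Consani, *Quasi-inner functions and local factors*, J. Number Theory **226**
(2021) 139–167 = arXiv:2008.10974 [bib: `ConnesConsani2021QuasiInner`], Theorem 4.8 and its proof
(arXiv chunk p0014:L62–L64: «The results of §4.3 continue to hold with minor changes if one replaces
`ρ_∞` by `ρ_∞^{(m,k)}` … the decay of the terms `|ρ_∞^{(m,k)}(2πin/log p)|` is now governed by Lemma 4.6
(i) … one thus gets an infinitesimal of order `1/(2m)`»), with the proof of Theorem 4.4 (ii)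
(p0011:L102–p0012:L35).  THEOREMS ONLY (no definition, no named fact).  Cell `rh-crit/cc`, row t18.

## The assembly (RH-FREE) — the file `QuasiInnerProductHankel.lean` (seat t17, Thm 4.4 (ii)) run for the
## factor `ρ_∞^{(m,k)}ρ_p`

The scalar input is t17's residue computation `exists_fourierCoeff_kappaFactorPrime_eq`
(`QuasiInnerFactorPrimeResidues.lean`): the negative Fourier coefficients of `κ^{(m,k)}κ_p|S¹` are
`Σ_{n ≥ 0, (k,n) ≠ (0,0)} c_n x_n^ℓ + Σ_{n≠0} ρ_∞^{(m,k)}(2πin/log p)·w_n x_p(n)^ℓ + (A + Bℓ)(−⅓)^ℓ`,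
`x_n = ψ⁻¹(−2k−2mn)`, `c_n = −8r_nρ_p(−2k−2mn)(2(−2k−2mn)−3)⁻²`, `w_n = 8(1−p⁻¹)log p(4πn+3i log p)⁻²`.
Both sides of `(1 − 𝒫)κ^{(m,k)}κ_p𝒫 = ℰ_∞ + ((1−p)/p)U₋VDIV*U₊* + ℰ₀` are bounded operators and are
compared through their matrices in the Fourier basis, exactly as in `thm_4_4_ii_holds`:
`ℰ_∞ = Σ_n c_n|ξ_{x_n}⟩⟨η_{x_n}|` (norm-convergent; of INFINITE order by the factorial decay of the
residues `r_n` of `ρ_∞^{(m,k)}`, t17's `norm_rhoFactor_residue_le` and `isInfiniteOrder_of_hasSum_rankOne'`),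
`ℰ_p = ((1−p)/p)U₋VDIV*U₊*` with `V` from Lemmas 3.3–3.4 (`lemma_3_3_holds`, `lemma_3_4_holds`), `I` the
involution (t17's `exists_lpInvolution`) and `D = D^{(m,k)}` the diagonal `Dδ_0 = 0`,
`Dδ_n = ρ_∞^{(m,k)}(2πin/log p)δ_n` of ORDER `1/(2m)` (t18's `exists_diag_rhoFactor_primePole`, the decay
of Lemma 4.6 (i)) — hence `ℰ_p` of order `1/(2m)` (two-sided ideal, t17's `IsInfinitesimalOfOrder.conj`) —
whose strong expansion is t18's `hasSum_rankOne_primeModel_diag`, and the rank `≤ 2` operator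
`ℰ₀ = A|ξ_{x₀}⟩⟨η_{x₀}| + B(|ξ₁⟩⟨η_{x₀}| + |ξ_{x₀}⟩⟨η₁|)`, `x₀ = −⅓`.  The sum is of order `1/(2m)`.

* `hasSum_inner_rankOneSeries` — the matrix of a norm-convergent Hankel series `Σ a_n|ξ_{x_n}⟩⟨η_{x_n}|`.
* `hasSum_inner_fourierLp_negSucc_primeModel_diag'`, `inner_fourierLp_natCast_primeModel_diag`,
  `primeModel_diag_fourierLp_negSucc` — the matrix of `((1−p)/p)U₋VDIV*U₊*` for a general diagonal `D`.
* `isInfinitesimalOfOrder_hardyOffDiag_rhoFactor_mul_kappaPrime` — **`(1 − 𝒫)κ^{(m,k)}κ_p𝒫` is an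
  infinitesimal of order `1/(2m)`** (`0 ≤ k < m`, `p` prime): the per-factor input of Theorem 4.8, in the
  spelling frozen on the cell board for `thm_4_8_of_factorOrder` (`QuasiInnerProductAlgebra.lean`).
* `thm_4_8_holds : thm_4_8` — **Theorem 4.8 PROVED**; discharges the named fact of `QuasiInnerProducts.lean`
  (whence `isQuasiInnerLeftHalfPlane_placeRatio` = Theorem 4.1 for every finite `F`, t18's conditional
  corollary `thm_4_1` made unconditional; Theorem 4.4 (i) is already t17's `thm_4_4_i_unconditional`).

Nothing in this file bears on the truth of RH.
-/

noncomputable section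

open _root_.MeasureTheory _root_.Complex AddCircle Filter Set
open scoped Real Topology Nat InnerProductSpace ComplexConjugate ENNReal

namespace Literature.NumberTheory.ConnesConsani2021

namespace QuasiInner

/-! ### A. Plumbing: vectors given by their Fourier expansions (private copies of t17's lemmas) -/

section Plumbing

/-- RH-FREE. Two vectors of `L²(S¹)` with the same Fourier coefficients are equal. [folklore] -/
private theorem fh_eq_of_inner_fourierLp_eq {v w : Lp ℂ 2 (haarAddCircle (T := (1 : ℝ)))}
    (h : ∀ n : ℤ, ⟪fourierLp (T := 1) 2 n, v⟫_ℂ = ⟪fourierLp (T := 1) 2 n, w⟫_ℂ) : v = w := by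
  apply (fourierBasis (T := 1)).repr.injective
  ext n
  have e : ∀ u : Lp ℂ 2 (haarAddCircle (T := (1 : ℝ))),
      (fourierBasis (T := 1)).repr u n = ⟪fourierLp (T := 1) 2 n, u⟫_ℂ := fun u => by
    rw [HilbertBasis.repr_apply_apply, coe_fourierBasis]
  rw [e, e, h n]

/-- RH-FREE. Fourier coefficients only depend on the a.e. class. [folklore] -/
private theorem fh_fourierCoeff_congr_ae {f g : AddCircle (1 : ℝ) → ℂ}
    (h : f =ᵐ[haarAddCircle (T := 1)] g) (n : ℤ) :
    fourierCoeff (T := 1) f n = fourierCoeff (T := 1) g n := by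
  simp only [fourierCoeff]
  exact integral_congr_ae (by filter_upwards [h] with x hx; simp only [hx])

/-- RH-FREE. If `v = Σ_i g(i) e_{σ(i)}` along an injective family of modes, then `⟨e_{σ(i)} | v⟩ = g(i)`.
[folklore] -/
private theorem fh_inner_fourierLp_of_hasSum {ι : Type*} {σ : ι → ℤ} (hσ : Function.Injective σ)
    {g : ι → ℂ} {v : Lp ℂ 2 (haarAddCircle (T := (1 : ℝ)))}
    (h : HasSum (fun i => g i • fourierLp (T := 1) 2 (σ i)) v) (i : ι) :
    ⟪fourierLp (T := 1) 2 (σ i), v⟫_ℂ = g i := by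
  classical
  have h1 := (innerSL ℂ (fourierLp (T := 1) 2 (σ i))).hasSum h
  simp only [innerSL_apply_apply, inner_smul_right] at h1
  have hon := orthonormal_iff_ite.1 (orthonormal_fourier (T := (1 : ℝ)))
  have hterm : (fun j : ι => g j * ⟪fourierLp (T := 1) 2 (σ i), fourierLp (T := 1) 2 (σ j)⟫_ℂ) =
      fun j => if j = i then g i else 0 := by
    funext j
    rw [hon]
    by_cases hji : j = i
    · subst hji; simp
    · have : σ i ≠ σ j := fun h => hji (hσ h).symm
      rw [if_neg this, if_neg hji, mul_zero]
  rw [hterm] at h1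
  exact h1.unique (hasSum_ite_eq i (g i))

/-- RH-FREE. … and `⟨e_j | v⟩ = 0` for every mode `e_j` outside the family. [folklore] -/
private theorem fh_inner_fourierLp_of_hasSum_eq_zero {ι : Type*} {σ : ι → ℤ}
    {g : ι → ℂ} {v : Lp ℂ 2 (haarAddCircle (T := (1 : ℝ)))}
    (h : HasSum (fun i => g i • fourierLp (T := 1) 2 (σ i)) v) {j : ℤ} (hj : ∀ i, σ i ≠ j) :
    ⟪fourierLp (T := 1) 2 j, v⟫_ℂ = 0 := by
  classical
  have h1 := (innerSL ℂ (fourierLp (T := 1) 2 j)).hasSum h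
  simp only [innerSL_apply_apply, inner_smul_right] at h1
  have hon := orthonormal_iff_ite.1 (orthonormal_fourier (T := (1 : ℝ)))
  have hterm : (fun i : ι => g i * ⟪fourierLp (T := 1) 2 j, fourierLp (T := 1) 2 (σ i)⟫_ℂ) =
      fun _ => 0 := by
    funext i
    rw [hon, if_neg (fun h => hj i h.symm), mul_zero]
  rw [hterm] at h1
  exact h1.unique hasSum_zero

/-- RH-FREE. The sequence `k ↦ k x₀^k` (`|x₀| < 1`) is square summable. [folklore] -/
private theorem fh_memℓp_mul_pow {x₀ : ℂ} (hx : ‖x₀‖ < 1) : Memℓp (fun k : ℕ => (k : ℂ) * x₀ ^ k) 2 := by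
  rw [memℓp_gen_iff (by norm_num)]
  have hr : ‖(‖x₀‖ ^ 2 : ℝ)‖ < 1 := by
    rw [Real.norm_eq_abs, abs_of_nonneg (by positivity)]
    nlinarith [norm_nonneg x₀]
  have h := summable_pow_mul_geometric_of_norm_lt_one 2 hr
  refine h.congr fun k => ?_
  rw [ENNReal.toReal_ofNat, Real.rpow_two, norm_mul, norm_pow, Complex.norm_natCast]
  ring

/-- RH-FREE. Coordinates of `toL2SeqOrZero (k ↦ k x₀^k)`. [folklore] -/
private theorem fh_toL2SeqOrZero_mul_pow_apply {x₀ : ℂ} (hx : ‖x₀‖ < 1) (k : ℕ) :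
    toL2SeqOrZero (fun k : ℕ => (k : ℂ) * x₀ ^ k) k = (k : ℂ) * x₀ ^ k := by
  simp only [toL2SeqOrZero, fh_memℓp_mul_pow hx, dif_pos]

/-- RH-FREE. Scalar multiples keep the order (`c • T = (c • 1) ∘ T`, left ideal). [folklore] -/
private theorem fh_order_smul {H : Type*} [NormedAddCommGroup H] [NormedSpace ℂ H] {T : H →L[ℂ] H}
    {α : ℝ} (h : IsInfinitesimalOfOrder T α) (c : ℂ) : IsInfinitesimalOfOrder (c • T) α := by
  have h1 := h.comp_left (c • (1 : H →L[ℂ] H))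
  have e : (c • (1 : H →L[ℂ] H)).comp T = c • T := by
    ext v; simp
  rwa [e] at h1

/-- RH-FREE. The geometry of the poles in the disk: for `p = −q`, `q ≥ 0`, `x = ψ⁻¹(p) = (2p+1)/(2p−3)`
satisfies `|x| ≤ 1 − 2/(2q+3)` and `|2p − 3| = 2q + 3`. [folklore] -/
private theorem fh_pole_geometry {q : ℝ} (hq : 0 ≤ q) :
    ‖(2 * (-((q : ℝ) : ℂ)) + 1) / (2 * (-((q : ℝ) : ℂ)) - 3)‖ ≤ 1 - 2 / (2 * q + 3) ∧
      ‖2 * (-((q : ℝ) : ℂ)) - 3‖ = 2 * q + 3 := by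
  have h3 : 2 * (-((q : ℝ) : ℂ)) - 3 = (((-(2 * q + 3) : ℝ)) : ℂ) := by push_cast; ring
  have h1 : 2 * (-((q : ℝ) : ℂ)) + 1 = (((-(2 * q - 1) : ℝ)) : ℂ) := by push_cast; ring
  have hpos : 0 < 2 * q + 3 := by linarith
  rw [h3, h1, norm_div, Complex.norm_real, Complex.norm_real, Real.norm_eq_abs, Real.norm_eq_abs, abs_neg,
    abs_neg, abs_of_pos hpos]
  refine ⟨?_, rfl⟩
  rw [div_le_iff₀ hpos, show (1 - 2 / (2 * q + 3)) * (2 * q + 3) = 2 * q + 1 by field_simp; ring]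
  exact abs_le.2 ⟨by linarith, by linarith⟩

end Plumbing

/-! ### B. The matrix of a norm-convergent Hankel series `Σ_n a_n|ξ_{x_n}⟩⟨η_{x_n}|` -/

section HankelSeries

/-- RH-FREE. **The matrix of `ℰ = Σ_n a_n|ξ_{x_n}⟩⟨η_{x_n}|`** (norm-convergent, `|x_n| < 1`): for `b ≥ 0`,
`⟨e_{−k−1} | ℰ e_b⟩ = Σ_n a_n x_n^{k+b}` (`⟨e_{−k−1}|ξ_x⟩ = x^k`, `⟨η_x|e_b⟩ = x^b`); `⟨e_a | ℰ v⟩ = 0` for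
`a ≥ 0`; `ℰ e_{−m−1} = 0` — the computation of the matrix of `ℰ_∞` in the proof of Theorem 4.4 (ii).
[cite: ConnesConsani2021QuasiInner, Thm 4.4 (ii) proof (arXiv chunk p0011:L100–p0012:L3) with Lemma 2.2 (p0006:L30–L41)] -/
theorem hasSum_inner_rankOneSeries {x a : ℕ → ℂ} (hx : ∀ n, ‖x n‖ < 1)
    {E : Lp ℂ 2 (haarAddCircle (T := (1 : ℝ))) →L[ℂ] Lp ℂ 2 (haarAddCircle (T := (1 : ℝ)))}
    (hE : HasSum (fun n : ℕ => a n • InnerProductSpace.rankOne ℂ (xiVec 1 (x n)) (etaVec 1 (x n))) E) :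
    (∀ k b : ℕ, HasSum (fun n : ℕ => a n * x n ^ (k + b))
      ⟪fourierLp (T := 1) 2 (-(k + 1 : ℤ)), E (fourierLp (T := 1) 2 (b : ℤ))⟫_ℂ) ∧
    (∀ (c : ℕ) (v : Lp ℂ 2 (haarAddCircle (T := 1))), ⟪fourierLp (T := 1) 2 (c : ℤ), E v⟫_ℂ = 0) ∧
    (∀ m : ℕ, E (fourierLp (T := 1) 2 (-(m + 1 : ℤ))) = 0) := by
  -- evaluation on a vector
  have hEv : ∀ v, HasSum (fun n : ℕ => (a n * ⟪etaVec 1 (x n), v⟫_ℂ) • xiVec 1 (x n)) (E v) := by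
    intro v
    have h := (ContinuousLinearMap.apply ℂ (Lp ℂ 2 (haarAddCircle (T := 1))) v).hasSum hE
    simp only [ContinuousLinearMap.apply_apply, FunLike.coe_smul, Pi.smul_apply,
      InnerProductSpace.rankOne_apply, smul_smul] at h
    exact h
  refine ⟨fun k b => ?_, fun c v => ?_, fun m => ?_⟩
  · have hterm2 : ∀ n : ℕ, ⟪fourierLp (T := 1) 2 (-(k + 1 : ℤ)),
        (a n * ⟪etaVec 1 (x n), fourierLp (T := 1) 2 (b : ℤ)⟫_ℂ) • xiVec 1 (x n)⟫_ℂ =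
        a n * x n ^ (k + b) := by
      intro n
      rw [inner_smul_right, inner_fourierLp_negSucc_xiVec 1 _ (hx _) k, ← inner_conj_symm,
        inner_fourierLp_natCast_etaVec _ (hx _) b, map_pow, Complex.conj_conj, pow_add]
      ring
    have h := (innerSL ℂ (fourierLp (T := 1) 2 (-(k + 1 : ℤ)))).hasSum
      (hEv (fourierLp (T := 1) 2 (b : ℤ)))
    simp only [innerSL_apply_apply, hterm2] at h
    exact h
  · have hterm3 : ∀ n : ℕ, ⟪fourierLp (T := 1) 2 (c : ℤ),
        (a n * ⟪etaVec 1 (x n), v⟫_ℂ) • xiVec 1 (x n)⟫_ℂ = 0 := by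
      intro n
      rw [inner_smul_right, inner_fourierLp_natCast_xiVec 1 _ (hx _) c, mul_zero]
    have h := (innerSL ℂ (fourierLp (T := 1) 2 (c : ℤ))).hasSum (hEv v)
    simp only [innerSL_apply_apply, hterm3] at h
    exact h.unique hasSum_zero
  · have hterm4 : ∀ n : ℕ, (a n * ⟪etaVec 1 (x n), fourierLp (T := 1) 2 (-(m + 1 : ℤ))⟫_ℂ) •
        xiVec 1 (x n) = 0 := by
      intro n
      rw [← inner_conj_symm, inner_fourierLp_negSucc_etaVec _ (hx _) m, map_zero, mul_zero, zero_smul]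
    have h := hEv (fourierLp (T := 1) 2 (-(m + 1 : ℤ)))
    simp only [hterm4] at h
    exact h.unique hasSum_zero

end HankelSeries

/-! ### C. The matrix of `((1−p)/p)U₋VDIV*U₊*` for a general diagonal `D` -/

section PrimeModelDiag

/-- RH-FREE. **The matrix of `ℰ_p = ((1−p)/p)U₋VDIV*U₊*` with a general diagonal `Dδ_n = d_nδ_n`**, entries
`(−k−1, b)`, `b ≥ 0`: `⟨e_{−k−1} | ℰ_p e_b⟩ = Σ_n d_n w_n x_p(n)^{k+b}`, `w_n = 8(1−p⁻¹)log p(4πn+3i log p)⁻²`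
(from the strong expansion `hasSum_rankOne_primeModel_diag`).
[cite: ConnesConsani2021QuasiInner, Thm 4.4 (ii) proof, display «uinftypoff2» (arXiv chunk p0012:L3–L18)] -/
theorem hasSum_inner_fourierLp_negSucc_primeModel_diag' {p : ℕ} (hp : p.Prime)
    (V : lp (fun _ : ℤ => ℂ) 2 →L[ℂ] lp (fun _ : ℕ => ℂ) 2)
    (Iop Dop : lp (fun _ : ℤ => ℂ) 2 →L[ℂ] lp (fun _ : ℤ => ℂ) 2) (d : ℤ → ℂ)
    (hV : ∀ n : ℤ, V (lp.single 2 n (1 : ℂ)) = zetaVec p n)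
    (hI : ∀ n : ℤ, Iop (lp.single 2 n (1 : ℂ)) = lp.single 2 (-n) (1 : ℂ))
    (hD : ∀ n : ℤ, Dop (lp.single 2 n (1 : ℂ)) = d n • lp.single 2 n (1 : ℂ))
    (k b : ℕ) :
    HasSum (fun n : ℤ => d n *
        (8 * (1 - (p : ℂ)⁻¹) * Real.log p / (4 * π * n + 3 * I * Real.log p) ^ 2 * xPrime p n ^ (k + b)))
      ⟪fourierLp (T := 1) 2 (-(k + 1 : ℤ)),
        ((((((1 - (p : ℝ)) / p : ℝ)) : ℂ) •
            ((hardyIsoMinus 1).toContinuousLinearMap ∘L V ∘L Dop ∘L Iop ∘L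
              (ContinuousLinearMap.adjoint V) ∘L
              ContinuousLinearMap.adjoint (hardyIsoPlus 1).toContinuousLinearMap))
          (fourierLp (T := 1) 2 (b : ℤ)))⟫_ℂ := by
  have hp1 : 1 < p := hp.one_lt
  have h := (innerSL ℂ (fourierLp (T := 1) 2 (-(k + 1 : ℤ)))).hasSum
    (hasSum_rankOne_primeModel_diag hp V Iop Dop d hV hI hD (fourierLp (T := 1) 2 (b : ℤ)))
  simp only [innerSL_apply_apply] at h
  have hterm : (fun n : ℤ => ⟪fourierLp (T := 1) 2 (-(k + 1 : ℤ)),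
      (((d n * ((8 * (1 - (p : ℂ)⁻¹) * Real.log p) / (4 * π * n + 3 * I * Real.log p) ^ 2)) •
        InnerProductSpace.rankOne ℂ (xiVec 1 (xPrime p n)) (etaVec 1 (xPrime p n)))
        (fourierLp (T := 1) 2 (b : ℤ)))⟫_ℂ) =
      fun n : ℤ => d n *
        (8 * (1 - (p : ℂ)⁻¹) * Real.log p / (4 * π * n + 3 * I * Real.log p) ^ 2 * xPrime p n ^ (k + b)) := by
    funext n
    have hx : ‖xPrime p n‖ < 1 := norm_xPrime_lt_one hp1 n
    rw [FunLike.coe_smul, Pi.smul_apply, InnerProductSpace.rankOne_apply, inner_smul_right, inner_smul_right,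
      inner_fourierLp_negSucc_xiVec 1 _ hx k, ← inner_conj_symm, inner_fourierLp_natCast_etaVec _ hx b,
      map_pow, Complex.conj_conj, pow_add]
    ring
  rw [hterm] at h
  exact h

/-- RH-FREE. `((1−p)/p)U₋VDIV*U₊*` (general diagonal `D`) has no entries in non-negative rows:
`⟨e_a | ℰ_p v⟩ = 0`, `a ≥ 0`. [cite: ConnesConsani2021QuasiInner, Thm 4.4 (ii) proof (arXiv chunk p0012:L3–L18) with Lemma 2.2 (p0006:L30–L41)] -/
theorem inner_fourierLp_natCast_primeModel_diag {p : ℕ} (hp : p.Prime)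
    (V : lp (fun _ : ℤ => ℂ) 2 →L[ℂ] lp (fun _ : ℕ => ℂ) 2)
    (Iop Dop : lp (fun _ : ℤ => ℂ) 2 →L[ℂ] lp (fun _ : ℤ => ℂ) 2) (d : ℤ → ℂ)
    (hV : ∀ n : ℤ, V (lp.single 2 n (1 : ℂ)) = zetaVec p n)
    (hI : ∀ n : ℤ, Iop (lp.single 2 n (1 : ℂ)) = lp.single 2 (-n) (1 : ℂ))
    (hD : ∀ n : ℤ, Dop (lp.single 2 n (1 : ℂ)) = d n • lp.single 2 n (1 : ℂ))
    (a : ℕ) (b : ℤ) :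
    ⟪fourierLp (T := 1) 2 (a : ℤ),
      ((((((1 - (p : ℝ)) / p : ℝ)) : ℂ) •
          ((hardyIsoMinus 1).toContinuousLinearMap ∘L V ∘L Dop ∘L Iop ∘L
            (ContinuousLinearMap.adjoint V) ∘L
            ContinuousLinearMap.adjoint (hardyIsoPlus 1).toContinuousLinearMap))
        (fourierLp (T := 1) 2 b))⟫_ℂ = 0 := by
  have hp1 : 1 < p := hp.one_lt
  have h := (innerSL ℂ (fourierLp (T := 1) 2 (a : ℤ))).hasSum
    (hasSum_rankOne_primeModel_diag hp V Iop Dop d hV hI hD (fourierLp (T := 1) 2 b))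
  simp only [innerSL_apply_apply] at h
  have hterm : (fun n : ℤ => ⟪fourierLp (T := 1) 2 (a : ℤ),
      (((d n * ((8 * (1 - (p : ℂ)⁻¹) * Real.log p) / (4 * π * n + 3 * I * Real.log p) ^ 2)) •
        InnerProductSpace.rankOne ℂ (xiVec 1 (xPrime p n)) (etaVec 1 (xPrime p n)))
        (fourierLp (T := 1) 2 b))⟫_ℂ) = fun _ : ℤ => 0 := by
    funext n
    have hx : ‖xPrime p n‖ < 1 := norm_xPrime_lt_one hp1 n
    rw [FunLike.coe_smul, Pi.smul_apply, InnerProductSpace.rankOne_apply, inner_smul_right, inner_smul_right,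
      inner_fourierLp_natCast_xiVec 1 _ hx a, mul_zero, mul_zero]
  rw [hterm] at h
  exact h.unique hasSum_zero

/-- RH-FREE. `((1−p)/p)U₋VDIV*U₊*` (general diagonal `D`) kills the negative modes: `ℰ_p e_{−m−1} = 0`.
[cite: ConnesConsani2021QuasiInner, Thm 4.4 (ii) proof (arXiv chunk p0012:L3–L18) with Lemma 2.2 (p0006:L41)] -/
theorem primeModel_diag_fourierLp_negSucc {p : ℕ} (hp : p.Prime)
    (V : lp (fun _ : ℤ => ℂ) 2 →L[ℂ] lp (fun _ : ℕ => ℂ) 2)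
    (Iop Dop : lp (fun _ : ℤ => ℂ) 2 →L[ℂ] lp (fun _ : ℤ => ℂ) 2) (d : ℤ → ℂ)
    (hV : ∀ n : ℤ, V (lp.single 2 n (1 : ℂ)) = zetaVec p n)
    (hI : ∀ n : ℤ, Iop (lp.single 2 n (1 : ℂ)) = lp.single 2 (-n) (1 : ℂ))
    (hD : ∀ n : ℤ, Dop (lp.single 2 n (1 : ℂ)) = d n • lp.single 2 n (1 : ℂ))
    (m : ℕ) :
    ((((((1 - (p : ℝ)) / p : ℝ)) : ℂ) •
          ((hardyIsoMinus 1).toContinuousLinearMap ∘L V ∘L Dop ∘L Iop ∘L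
            (ContinuousLinearMap.adjoint V) ∘L
            ContinuousLinearMap.adjoint (hardyIsoPlus 1).toContinuousLinearMap))
        (fourierLp (T := 1) 2 (-(m + 1 : ℤ)))) = 0 := by
  have hp1 : 1 < p := hp.one_lt
  have h := hasSum_rankOne_primeModel_diag hp V Iop Dop d hV hI hD (fourierLp (T := 1) 2 (-(m + 1 : ℤ)))
  have hterm : (fun n : ℤ =>
      (((d n * ((8 * (1 - (p : ℂ)⁻¹) * Real.log p) / (4 * π * n + 3 * I * Real.log p) ^ 2)) •
        InnerProductSpace.rankOne ℂ (xiVec 1 (xPrime p n)) (etaVec 1 (xPrime p n)))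
        (fourierLp (T := 1) 2 (-(m + 1 : ℤ))))) = fun _ : ℤ => 0 := by
    funext n
    have hx : ‖xPrime p n‖ < 1 := norm_xPrime_lt_one hp1 n
    rw [FunLike.coe_smul, Pi.smul_apply, InnerProductSpace.rankOne_apply, ← inner_conj_symm,
      inner_fourierLp_negSucc_etaVec _ hx m, map_zero, zero_smul, smul_zero]
  rw [hterm] at h
  exact h.unique hasSum_zero

end PrimeModelDiag

/-! ### D. The per-factor order estimate and Theorem 4.8 -/

section TheoremFourEight

set_option maxHeartbeats 800000 in
/-- RH-FREE. **`(1 − 𝒫)κ^{(m,k)}κ_p𝒫` is an infinitesimal of order `1/(2m)`** (`0 ≤ k < m`, `p` prime) —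
«The results of §4.3 continue to hold with minor changes if one replaces `ρ_∞` by `ρ_∞^{(m,k)}`.  The only
substantial change is that the decay of the terms `|ρ_∞^{(m,k)}(2πin/log p)|` is now governed by Lemma 4.6
(i)»: `(1 − 𝒫)κ^{(m,k)}κ_p𝒫 = ℰ_∞ + ((1−p)/p)U₋VD^{(m,k)}IV*U₊* + ℰ₀` by matrix comparison in the Fourier
basis (t17's residue computation `exists_fourierCoeff_kappaFactorPrime_eq`), with `ℰ_∞` of infinite order
(factorial decay of the residues of `ρ_∞^{(m,k)}`), `D^{(m,k)}` of order `1/(2m)` (Lemma 4.6 (i),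
`exists_diag_rhoFactor_primePole`) and `ℰ₀` of rank `≤ 2`.  This is the hypothesis `hB m k p` of
`thm_4_8_of_factorOrder`.
[cite: ConnesConsani2021QuasiInner, Thm 4.8 proof (arXiv chunk p0014:L64) with Thm 4.4 (ii) proof (p0011:L102–p0012:L35) and Thm 4.4 (i) proof (p0012:L19–L21)] -/
theorem isInfinitesimalOfOrder_hardyOffDiag_rhoFactor_mul_kappaPrime {m k p : ℕ} (hm : 0 < m)
    (hk : k < m) (hp : p.Prime) :
    IsInfinitesimalOfOrder
      (hardyOffDiag 1 (toLpOrZero ∞ haarAddCircle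
        (circleRestrict 1 fun v => rhoFactor m k (cayley v) * kappaPrime p v)))
      (1 / (2 * (m : ℝ))) := by
  have hp1 : 1 < p := hp.one_lt
  have hp1R : (1 : ℝ) < p := by exact_mod_cast hp1
  have hm0 : (0 : ℝ) < m := Nat.cast_pos.mpr hm
  have hα : (0 : ℝ) ≤ 1 / (2 * (m : ℝ)) := by positivity
  -- the symbol and its Fourier coefficients
  obtain ⟨-, -, hae⟩ := memLp_circleRestrict_rhoFactor_mul_kappaPrime hm k hp1
  obtain ⟨A, B, hcoef⟩ := exists_fourierCoeff_kappaFactorPrime_eq hm hk hp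
  -- the operators `V`, `I`, `D = D^{(m,k)}`
  obtain ⟨B₃, hB₃, -⟩ := (lemma_3_3_holds p hp).1
  obtain ⟨V, U, hV, -, -, -⟩ := lemma_3_4_holds p hp B₃ hB₃
  obtain ⟨Iop, hI⟩ := exists_lpInvolution
  obtain ⟨Dop, -, -, hD, hDord⟩ := exists_diag_rhoFactor_primePole hm k hp1
  -- the data of `ℰ_∞`: poles `P n = −2k − 2mn`, residues `Er n`, nodes `xs n = ψ⁻¹(P n)`, coefficients `cs n`
  set P : ℕ → ℂ := fun n => -(2 * (k : ℂ) + 2 * (m : ℂ) * (n : ℂ)) with hP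
  set Er : ℕ → ℂ := fun n => 2 * (m : ℂ) * ((π : ℂ) / m) ^ (1 / (2 * (m : ℂ)) - P n / m) *
    (Complex.Gamma ((1 - P n) / (2 * (m : ℂ)) + (k : ℂ) / (m : ℂ)))⁻¹ / ((-1) ^ n * (n ! : ℂ)) with hEr
  set xs : ℕ → ℂ := fun n => (2 * P n + 1) / (2 * P n - 3) with hxs
  set cs : ℕ → ℂ := fun n => if k = 0 ∧ n = 0 then (0 : ℂ) else
    -8 * Er n * rhoPrime p (P n) / (2 * P n - 3) ^ 2 with hcs
  have hPq : ∀ n : ℕ, P n = -(((2 * k + 2 * m * n : ℝ)) : ℂ) := by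
    intro n; simp only [hP]; push_cast; ring
  have hq : ∀ n : ℕ, (0 : ℝ) ≤ 2 * k + 2 * m * n := fun n => by positivity
  have hx : ∀ n : ℕ, ‖xs n‖ < 1 := by
    intro n
    show ‖(2 * P n + 1) / (2 * P n - 3)‖ < 1
    rw [hPq]
    refine ((fh_pole_geometry (hq n)).1).trans_lt ?_
    have : 0 < 2 / (2 * (2 * (k : ℝ) + 2 * m * n) + 3) := by positivity
    linarith
  -- the residues decay factorially; `|ρ_p(P n)| ≤ c_p` off `(k,n) = (0,0)`
  set C₀ : ℝ := 2 * (m : ℝ) * (π / m) ^ ((1 + 4 * k) / (2 * m) : ℝ) with hC₀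
  have hEle : ∀ n : ℕ, 2 ≤ n → ‖Er n‖ ≤ C₀ * ((π / m) ^ 2) ^ n / n ! := fun n hn =>
    norm_rhoFactor_residue_le hm k hn
  set cp : ℝ := (1 + (p : ℝ)⁻¹) / ((p : ℝ) ^ (2 : ℝ) - 1) with hcp
  have hcp0 : 0 ≤ cp := by
    have : 1 < (p : ℝ) ^ (2 : ℝ) := Real.one_lt_rpow hp1R (by norm_num)
    exact div_nonneg (by positivity) (by linarith)
  have hrho : ∀ n : ℕ, ¬(k = 0 ∧ n = 0) → ‖rhoPrime p (P n)‖ ≤ cp := by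
    intro n hkn
    refine norm_rhoPrime_le_of_re_le hp1 (by norm_num : (0 : ℝ) < 2) ?_
    rw [hPq, neg_re, ofReal_re]
    have : (2 : ℝ) ≤ 2 * k + 2 * m * n := by
      rcases Nat.eq_zero_or_pos n with hn | hn
      · subst hn
        have hk1 : 1 ≤ k := Nat.one_le_iff_ne_zero.mpr fun h => hkn ⟨h, rfl⟩
        have : (1 : ℝ) ≤ k := by exact_mod_cast hk1
        simp; linarith
      · have h1 : (1 : ℝ) ≤ n := by exact_mod_cast hn
        have h2 : (1 : ℝ) ≤ m := by exact_mod_cast hm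
        nlinarith [hq n, mul_le_mul h2 h1 zero_le_one (by linarith)]
    linarith
  -- the weighted bound `|cs n|‖ξ_{x_n}‖‖η_{x_n}‖ ≤ (4/3) c_p |Er n|`
  have hcw : ∀ n : ℕ, ‖cs n‖ * (‖xiVec 1 (xs n)‖ * ‖etaVec 1 (xs n)‖) ≤ 4 / 3 * cp * ‖Er n‖ := by
    intro n
    rw [norm_xiVec_mul_norm_etaVec (T := 1) (xs n) (hx n)]
    by_cases hkn : k = 0 ∧ n = 0
    · have h0 : cs n = 0 := by simp only [hcs, if_pos hkn]
      rw [h0, norm_zero, zero_mul]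
      positivity
    · have h1 : cs n = -8 * Er n * rhoPrime p (P n) / (2 * P n - 3) ^ 2 := by simp only [hcs, if_neg hkn]
      obtain ⟨hxle, h3⟩ := fh_pole_geometry (hq n)
      rw [← hPq] at hxle h3
      have hpos : (0 : ℝ) < 2 * (2 * k + 2 * m * n) + 3 := by positivity
      have hcn : ‖cs n‖ ≤ 8 * ‖Er n‖ * cp / (2 * (2 * (k : ℝ) + 2 * m * n) + 3) ^ 2 := by
        rw [h1, norm_div, norm_mul, norm_mul, norm_neg, norm_pow, h3]
        refine div_le_div_of_nonneg_right ?_ (by positivity)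
        norm_num
        exact mul_le_mul_of_nonneg_left (hrho n hkn) (by positivity)
      have hx1 : ‖xs n‖ ≤ 1 - 2 / (2 * (2 * (k : ℝ) + 2 * m * n) + 3) := hxle
      have hxn : 0 ≤ ‖xs n‖ := norm_nonneg _
      have hinv : (1 - ‖xs n‖ ^ 2)⁻¹ ≤ (2 * (2 * (k : ℝ) + 2 * m * n) + 3) / 2 := by
        have hle : 2 / (2 * (2 * (k : ℝ) + 2 * m * n) + 3) ≤ 1 - ‖xs n‖ ^ 2 := by
          have h2 : 1 - ‖xs n‖ ≤ 1 - ‖xs n‖ ^ 2 := by nlinarith [(hx n).le]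
          linarith
        rw [show (2 * (2 * (k : ℝ) + 2 * m * n) + 3) / 2 = (2 / (2 * (2 * (k : ℝ) + 2 * m * n) + 3))⁻¹ by
          rw [inv_div]]
        exact inv_anti₀ (by positivity) hle
      calc ‖cs n‖ * (1 - ‖xs n‖ ^ 2)⁻¹
          ≤ 8 * ‖Er n‖ * cp / (2 * (2 * (k : ℝ) + 2 * m * n) + 3) ^ 2 * ((2 * (2 * (k : ℝ) + 2 * m * n) + 3) / 2) :=
            mul_le_mul hcn hinv (inv_nonneg.mpr (by nlinarith [(hx n).le])) (by positivity)
        _ = 4 * cp * ‖Er n‖ / (2 * (2 * (k : ℝ) + 2 * m * n) + 3) := by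
            field_simp
            ring
        _ ≤ 4 / 3 * cp * ‖Er n‖ := by
            rw [div_le_iff₀ hpos]
            nlinarith [mul_nonneg (hq n) (mul_nonneg hcp0 (norm_nonneg (Er n)))]
  -- polynomially weighted summability: `ℰ_∞` is of infinite order
  have hweight : ∀ K : ℕ, Summable fun n : ℕ =>
      ‖cs n‖ * ‖xiVec 1 (xs n)‖ * ‖etaVec 1 (xs n)‖ * ((n : ℝ) + 1) ^ K := by
    intro K
    have hmaj : Summable fun n : ℕ =>
        4 / 3 * cp * (C₀ * ((2 : ℝ) ^ K) * (((2 : ℝ) ^ K * (π / m) ^ 2) ^ n / n !)) := by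
      have := ((Real.summable_pow_div_factorial ((2 : ℝ) ^ K * (π / m) ^ 2)).mul_left
        (C₀ * (2 : ℝ) ^ K)).mul_left (4 / 3 * cp)
      refine this.congr fun n => ?_
      ring
    refine Summable.of_norm_bounded_eventually hmaj ?_
    rw [Nat.cofinite_eq_atTop]
    filter_upwards [eventually_ge_atTop 2] with n hn
    rw [Real.norm_eq_abs, abs_of_nonneg (by positivity)]
    have hnk : ((n : ℝ) + 1) ^ K ≤ (2 : ℝ) ^ K * ((2 : ℝ) ^ K) ^ n := by
      have h1 : (n : ℝ) + 1 ≤ (2 : ℝ) ^ (n + 1) := by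
        have := Nat.lt_two_pow_self (n := n + 1)
        exact_mod_cast this.le
      calc ((n : ℝ) + 1) ^ K ≤ ((2 : ℝ) ^ (n + 1)) ^ K := pow_le_pow_left₀ (by positivity) h1 K
        _ = (2 : ℝ) ^ K * ((2 : ℝ) ^ K) ^ n := by rw [← pow_mul, ← pow_mul, ← pow_add]; ring_nf
    calc ‖cs n‖ * ‖xiVec 1 (xs n)‖ * ‖etaVec 1 (xs n)‖ * ((n : ℝ) + 1) ^ K
        = (‖cs n‖ * (‖xiVec 1 (xs n)‖ * ‖etaVec 1 (xs n)‖)) * ((n : ℝ) + 1) ^ K := by ring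
      _ ≤ (4 / 3 * cp * ‖Er n‖) * ((2 : ℝ) ^ K * ((2 : ℝ) ^ K) ^ n) :=
          mul_le_mul (hcw n) hnk (by positivity) (by positivity)
      _ ≤ (4 / 3 * cp * (C₀ * ((π / m) ^ 2) ^ n / n !)) * ((2 : ℝ) ^ K * ((2 : ℝ) ^ K) ^ n) := by
          gcongr
          exact hEle n hn
      _ = 4 / 3 * cp * (C₀ * ((2 : ℝ) ^ K) * (((2 : ℝ) ^ K * (π / m) ^ 2) ^ n / n !)) := by
          rw [mul_pow]; ring
  -- `ℰ_∞ = Σ cs n |ξ_{xs n}⟩⟨η_{xs n}|`, norm-convergent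
  have hsn : Summable fun n : ℕ =>
      ‖cs n • InnerProductSpace.rankOne ℂ (xiVec 1 (xs n)) (etaVec 1 (xs n))‖ := by
    refine (hweight 0).congr fun n => ?_
    rw [norm_smul, InnerProductSpace.norm_rankOne, pow_zero, mul_one, mul_assoc]
  obtain ⟨Einf, hEsum⟩ : ∃ E : Lp ℂ 2 (haarAddCircle (T := 1)) →L[ℂ] Lp ℂ 2 (haarAddCircle (T := 1)),
      HasSum (fun n : ℕ => cs n • InnerProductSpace.rankOne ℂ (xiVec 1 (xs n)) (etaVec 1 (xs n))) E :=
    ⟨_, hsn.of_norm.hasSum⟩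
  obtain ⟨hEmat, hErow, hEcol⟩ := hasSum_inner_rankOneSeries hx hEsum
  -- the rank-two operator `ℰ₀`
  have hx0 : ‖(-1 / 3 : ℂ)‖ < 1 := by norm_num
  have hxr : conj (-1 / 3 : ℂ) = (-1 / 3 : ℂ) := by
    rw [show (-1 / 3 : ℂ) = ((-1 / 3 : ℝ) : ℂ) by push_cast; ring, conj_ofReal]
  have hg₁k : ∀ k : ℕ, toL2SeqOrZero (fun k : ℕ => (k : ℂ) * (-1 / 3 : ℂ) ^ k) k = (k : ℂ) * (-1 / 3 : ℂ) ^ k :=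
    fun k => fh_toL2SeqOrZero_mul_pow_apply hx0 k
  obtain ⟨ξ₀, hξ₀⟩ : ∃ v : Lp ℂ 2 (haarAddCircle (T := 1)), v = xiVec 1 (-1 / 3 : ℂ) := ⟨_, rfl⟩
  obtain ⟨η₀, hη₀⟩ : ∃ v : Lp ℂ 2 (haarAddCircle (T := 1)), v = etaVec 1 (-1 / 3 : ℂ) := ⟨_, rfl⟩
  obtain ⟨ξ₁, hξ₁⟩ : ∃ v : Lp ℂ 2 (haarAddCircle (T := 1)),
      v = hardyIsoMinus 1 (toL2SeqOrZero (fun k : ℕ => (k : ℂ) * (-1 / 3 : ℂ) ^ k)) := ⟨_, rfl⟩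
  obtain ⟨η₁, hη₁⟩ : ∃ v : Lp ℂ 2 (haarAddCircle (T := 1)),
      v = hardyIsoPlus 1 (toL2SeqOrZero (fun k : ℕ => (k : ℂ) * (-1 / 3 : ℂ) ^ k)) := ⟨_, rfl⟩
  have hξ₁sum : HasSum (fun k : ℕ => ((k : ℂ) * (-1 / 3 : ℂ) ^ k) • fourierLp (T := 1) 2 (-(k + 1 : ℤ))) ξ₁ := by
    have h := hasSum_hardyIsoMinus 1 (toL2SeqOrZero (fun k : ℕ => (k : ℂ) * (-1 / 3 : ℂ) ^ k))
    simp only [hg₁k] at h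
    rw [hξ₁]
    exact h
  have hη₁sum : HasSum (fun k : ℕ => ((k : ℂ) * (-1 / 3 : ℂ) ^ k) • fourierLp (T := 1) 2 (k : ℤ)) η₁ := by
    have h := hasSum_hardyIsoPlus 1 (toL2SeqOrZero (fun k : ℕ => (k : ℂ) * (-1 / 3 : ℂ) ^ k))
    simp only [hg₁k] at h
    rw [hη₁]
    exact h
  have hσm : Function.Injective fun k : ℕ => (-(k + 1 : ℤ)) := fun a b h => by
    have : (a : ℤ) = b := by
      simp only [neg_inj] at h
      linarith
    exact_mod_cast this
  have hσp : Function.Injective fun k : ℕ => (k : ℤ) := fun a b h => by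
    have h' : (a : ℤ) = b := h
    exact_mod_cast h'
  -- entries of the four vectors
  have hξ₀neg : ∀ k : ℕ, ⟪fourierLp (T := 1) 2 (-(k + 1 : ℤ)), ξ₀⟫_ℂ = (-1 / 3 : ℂ) ^ k := fun k => by
    rw [hξ₀]; exact inner_fourierLp_negSucc_xiVec 1 _ hx0 k
  have hξ₀pos : ∀ a : ℕ, ⟪fourierLp (T := 1) 2 (a : ℤ), ξ₀⟫_ℂ = 0 := fun a => by
    rw [hξ₀]; exact inner_fourierLp_natCast_xiVec 1 _ hx0 a
  have hη₀pos : ∀ b : ℕ, ⟪η₀, fourierLp (T := 1) 2 (b : ℤ)⟫_ℂ = (-1 / 3 : ℂ) ^ b := by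
    intro b
    rw [hη₀, ← inner_conj_symm, inner_fourierLp_natCast_etaVec _ hx0 b, map_pow, Complex.conj_conj]
  have hη₀neg : ∀ m : ℕ, ⟪η₀, fourierLp (T := 1) 2 (-(m + 1 : ℤ))⟫_ℂ = 0 := by
    intro m
    rw [hη₀, ← inner_conj_symm, inner_fourierLp_negSucc_etaVec _ hx0 m, map_zero]
  have hξ₁neg : ∀ k : ℕ, ⟪fourierLp (T := 1) 2 (-(k + 1 : ℤ)), ξ₁⟫_ℂ = (k : ℂ) * (-1 / 3 : ℂ) ^ k :=
    fun k => fh_inner_fourierLp_of_hasSum hσm hξ₁sum k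
  have hξ₁pos : ∀ a : ℕ, ⟪fourierLp (T := 1) 2 (a : ℤ), ξ₁⟫_ℂ = 0 := fun a =>
    fh_inner_fourierLp_of_hasSum_eq_zero hξ₁sum fun k => by
      show (-(k + 1 : ℤ)) ≠ (a : ℤ); omega
  have hη₁pos : ∀ b : ℕ, ⟪η₁, fourierLp (T := 1) 2 (b : ℤ)⟫_ℂ = (b : ℂ) * (-1 / 3 : ℂ) ^ b := by
    intro b
    rw [← inner_conj_symm, fh_inner_fourierLp_of_hasSum hσp hη₁sum b, map_mul, map_pow, hxr,
      Complex.conj_natCast]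
  have hη₁neg : ∀ m : ℕ, ⟪η₁, fourierLp (T := 1) 2 (-(m + 1 : ℤ))⟫_ℂ = 0 := by
    intro m
    rw [← inner_conj_symm, fh_inner_fourierLp_of_hasSum_eq_zero hη₁sum (fun k => by
      show ((k : ℕ) : ℤ) ≠ -(m + 1 : ℤ); omega), map_zero]
  obtain ⟨E0, hE0⟩ : ∃ E : Lp ℂ 2 (haarAddCircle (T := 1)) →L[ℂ] Lp ℂ 2 (haarAddCircle (T := 1)),
      E = A • InnerProductSpace.rankOne ℂ ξ₀ η₀ +
        B • (InnerProductSpace.rankOne ℂ ξ₁ η₀ + InnerProductSpace.rankOne ℂ ξ₀ η₁) := ⟨_, rfl⟩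
  have hE0apply : ∀ v, E0 v = (A * ⟪η₀, v⟫_ℂ + B * ⟪η₁, v⟫_ℂ) • ξ₀ + (B * ⟪η₀, v⟫_ℂ) • ξ₁ := by
    intro v
    rw [hE0]
    simp only [_root_.add_apply, FunLike.coe_smul, Pi.smul_apply,
      InnerProductSpace.rankOne_apply, smul_add, smul_smul, add_smul]
    abel
  -- `ℰ_p = ((1−p)/p)U₋VD^{(m,k)}IV*U₊*`
  obtain ⟨Ep, hEp⟩ : ∃ E : Lp ℂ 2 (haarAddCircle (T := 1)) →L[ℂ] Lp ℂ 2 (haarAddCircle (T := 1)),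
      E = ((((1 - (p : ℝ)) / p : ℝ)) : ℂ) •
        ((hardyIsoMinus 1).toContinuousLinearMap ∘L V ∘L Dop ∘L Iop ∘L (ContinuousLinearMap.adjoint V) ∘L
          ContinuousLinearMap.adjoint (hardyIsoPlus 1).toContinuousLinearMap) := ⟨_, rfl⟩
  -- the identity `(1 − 𝒫)κ^{(m,k)}κ_p𝒫 = ℰ_∞ + ℰ_p + ℰ₀` by matrix comparison
  have heq : hardyOffDiag 1 (toLpOrZero ∞ haarAddCircle
      (circleRestrict 1 fun v => rhoFactor m k (cayley v) * kappaPrime p v)) = Einf + Ep + E0 := by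
    have hdense : Dense (Submodule.span ℂ (Set.range (fourierLp (T := 1) 2)) :
        Set (Lp ℂ 2 (haarAddCircle (T := 1)))) :=
      Submodule.dense_iff_topologicalClosure_eq_top.2 (span_fourierLp_closure_eq_top (by norm_num))
    refine ContinuousLinearMap.ext_on hdense ?_
    rintro _ ⟨j, rfl⟩
    rw [_root_.add_apply, _root_.add_apply]
    rcases j with b | j
    · -- column `b ≥ 0`
      rw [Int.ofNat_eq_natCast]
      refine fh_eq_of_inner_fourierLp_eq fun a => ?_
      rw [inner_add_right, inner_add_right]
      rcases a with a | a
      · -- row `a ≥ 0`: everything vanishes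
        rw [Int.ofNat_eq_natCast, inner_fourierLp_natCast_hardyOffDiag, hErow, hEp,
          inner_fourierLp_natCast_primeModel_diag hp V Iop Dop _ hV hI hD, hE0apply, inner_add_right,
          inner_smul_right, inner_smul_right, hξ₀pos, hξ₁pos]
        ring
      · -- row `−a−1`: the Fourier coefficient `(κ^{(m,k)}κ_p)^(−a−b−1)`
        rw [Int.negSucc_eq, inner_fourierLp_negSucc_hardyOffDiag_fourierLp_natCast,
          fh_fourierCoeff_congr_ae hae, ← (hEmat a b).tsum_eq, hEp,
          ← (hasSum_inner_fourierLp_negSucc_primeModel_diag' hp V Iop Dop _ hV hI hD a b).tsum_eq,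
          hE0apply, inner_add_right, inner_smul_right, inner_smul_right, hξ₀neg, hξ₁neg, hη₀pos, hη₁pos]
        have hc := hcoef (a + b)
        rw [show ((a + b + 1 : ℕ) : ℤ) = ((a + b : ℕ) : ℤ) + 1 by push_cast; ring] at hc
        rw [hc]
        have e1 : (fun n : ℕ => if k = 0 ∧ n = 0 then (0 : ℂ) else
            (-8 * (2 * (m : ℂ) * ((π : ℂ) / m) ^ (1 / (2 * (m : ℂ)) - (-(2 * (k : ℂ) + 2 * (m : ℂ) * (n : ℂ))) / m) *
              (Complex.Gamma ((1 - (-(2 * (k : ℂ) + 2 * (m : ℂ) * (n : ℂ)))) / (2 * (m : ℂ)) + (k : ℂ) / (m : ℂ)))⁻¹ /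
                ((-1) ^ n * (n ! : ℂ))) *
              rhoPrime p (-(2 * (k : ℂ) + 2 * (m : ℂ) * (n : ℂ))) /
                (2 * (-(2 * (k : ℂ) + 2 * (m : ℂ) * (n : ℂ))) - 3) ^ 2) *
              cayleyInv (-(2 * (k : ℂ) + 2 * (m : ℂ) * (n : ℂ))) ^ (a + b)) =
            fun n : ℕ => cs n * xs n ^ (a + b) := by
          funext n
          simp only [hcs, hxs, hEr, hP, cayleyInv]
          split_ifs with hkn
          · rw [zero_mul]
          · rfl
        have e2 : (fun n : ℤ => if n = 0 then (0 : ℂ) else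
            rhoFactor m k (2 * π * I * n / Real.log p) *
              (8 * (1 - (p : ℂ)⁻¹) * Real.log p / (4 * π * n + 3 * I * Real.log p) ^ 2 * xPrime p n ^ (a + b))) =
            fun n : ℤ => (if n = 0 then (0 : ℂ) else rhoFactor m k (2 * π * I * n / Real.log p)) *
              (8 * (1 - (p : ℂ)⁻¹) * Real.log p / (4 * π * n + 3 * I * Real.log p) ^ 2 *
                xPrime p n ^ (a + b)) := by
          funext n
          split_ifs with hn
          · rw [zero_mul]
          · rfl
        rw [e1, e2]
        push_cast
        ring
    · -- column `−j−1`: both sides vanish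
      rw [Int.negSucc_eq, hardyOffDiag_fourierLp_negSucc, hEcol, hEp,
        primeModel_diag_fourierLp_negSucc hp V Iop Dop _ hV hI hD, hE0apply, hη₀neg, hη₁neg]
      simp
  -- the three orders
  have hEinf : IsInfinitesimalOfOrder Einf (1 / (2 * (m : ℝ))) := by
    have hinf : IsInfiniteOrder Einf := isInfiniteOrder_of_hasSum_rankOne' hweight hEsum
    refine (((isInfiniteOrder_iff Einf).1 hinf) 1).of_le ?_
    rw [Nat.cast_one, div_le_one (by positivity)]
    have : (1 : ℝ) ≤ m := by exact_mod_cast hm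
    linarith
  have hEpord : IsInfinitesimalOfOrder Ep (1 / (2 * (m : ℝ))) := by
    rw [hEp]
    refine fh_order_smul ?_ _
    have h := hDord.conj ((hardyIsoMinus 1).toContinuousLinearMap ∘L V)
      (Iop ∘L (ContinuousLinearMap.adjoint V) ∘L
        ContinuousLinearMap.adjoint (hardyIsoPlus 1).toContinuousLinearMap)
    rwa [ContinuousLinearMap.comp_assoc] at h
  have hE0ord : IsInfinitesimalOfOrder E0 (1 / (2 * (m : ℝ))) := by
    have hle : LinearMap.range E0.toLinearMap ≤ Submodule.span ℂ ({ξ₀, ξ₁} : Set _) := by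
      rintro _ ⟨v, rfl⟩
      rw [ContinuousLinearMap.coe_coe, hE0apply]
      exact Submodule.add_mem _ (Submodule.smul_mem _ _ (Submodule.subset_span (by simp)))
        (Submodule.smul_mem _ _ (Submodule.subset_span (by simp)))
    haveI : FiniteDimensional ℂ (Submodule.span ℂ ({ξ₀, ξ₁} : Set (Lp ℂ 2 (haarAddCircle (T := (1 : ℝ)))))) :=
      FiniteDimensional.span_of_finite ℂ (Set.toFinite _)
    haveI hfin : FiniteDimensional ℂ (LinearMap.range E0.toLinearMap) := Submodule.finiteDimensional_of_le hle
    exact isInfinitesimalOfOrder_of_rank_le (le_of_eq (Module.finrank_eq_rank ℂ _).symm) _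
  rw [heq]
  exact (hEinf.add hα hEpord).add hα hE0ord

/-- RH-FREE. **Theorem 4.8 PROVED**: «The product `ρ_∞ ∏ ρ_p` of `m + 1` ratios of local `L`-factors
`ρ_v(z) = γ_v(z)/γ_v(1−z)` over a finite set of places of `ℚ` containing the archimedean place is a
quasi-inner function relative to `ℂ_− = {z ∈ ℂ | Re z ≤ ½}`.  The off diagonal part `(1 − 𝒫)ρ_∞∏ρ_p𝒫` is an
infinitesimal of order `1/(2m)`» — `thm_4_8_of_factorOrder` (Lemma 4.7 and the product algebra,
`QuasiInnerProductAlgebra.lean`) fed with the per-factor estimate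
`isInfinitesimalOfOrder_hardyOffDiag_rhoFactor_mul_kappaPrime`.  Discharges the named fact `thm_4_8` of
`QuasiInnerProducts.lean`; with it t18's conditional `thm_4_1`/`thm_4_4_i` become unconditional.
[cite: ConnesConsani2021QuasiInner, Thm 4.8 (arXiv chunk p0014:L62; proof p0014:L64)] -/
theorem thm_4_8_holds : thm_4_8 :=
  thm_4_8_of_factorOrder fun _m _k _p hm hk hp =>
    isInfinitesimalOfOrder_hardyOffDiag_rhoFactor_mul_kappaPrime hm hk hp

/-- RH-FREE. **Theorem 4.1 PROVED** (unconditionally): `ρ_∞∏_{p∈F}ρ_p` is quasi-inner relative to `ℂ₋` for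
every finite set `F` of primes (t18's conditional `thm_4_1` fed with `thm_4_8_holds` and t17's
`thm_2_1_holds`). [cite: ConnesConsani2021QuasiInner, Thm 4.1 (arXiv chunk p0011:L5)] -/
theorem isQuasiInnerLeftHalfPlane_placeRatio (F : Finset Nat.Primes) :
    IsQuasiInnerLeftHalfPlane (placeRatio F) :=
  thm_4_1 thm_4_8_holds thm_2_1_holds F

end TheoremFourEight

end QuasiInner

end Literature.NumberTheory.ConnesConsani2021

end
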